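import Summits.AnomalousDissipation.AnomalousDissipation.Theorems.MomentParityResolvedDissipationReduction

/-!
# `MomentParity.ResolvedDissipation` (stmt-AnomalousDissipation-14284): SUBLINEAR RESOLUTION —
# every sub-critical moment of the enstrophy tail is resolved by ONE schedule, uniformly in the level

Supports stmt-AnomalousDissipation-14284 (lead c2 of the crux chain, line `lions-l4-domination`; nothing here
closes an item).

The crux asks, at each `(f, ν, R)`, for ONE schedule `κ` with `∫ tail_{κ n}(u) dμ ≤ 1/(n+1)` for every admissible
law `μ` (probability, carried by level-`N` fields, supported in `‖u‖ ≤ R`, stationary for Galerkin NS at `(ν, f)` at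
every polynomial order) and every level `N`, where `tail_m(u) = ‖∇u‖² − ‖∇P_m u‖² = 4π² Σ_{|k|>m} |k|²|û(k)|²`
(`Torus.tailGradNormSq`). This file proves the same statement for EVERY EXPONENT `r < 1` in place of `r = 1`,
with an explicit rate, from the two `N`-uniform inputs already in the tree — the energy-row budget
`∫‖∇u‖² dμ ≤ ‖f‖₂R/ν` (`ensembleEnstrophy_le_budget`) and the Foias–Guillopé–Temam weighted `H²` bound
`∫ |Au|²/(1+‖∇u‖²)⁴ dμ ≤ C(f, ν)` (`weightedH2Bound_admissible`) — by a POINTWISE interpolation (spectral Chebyshev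
`4π²(m²+1) tail_m ≤ |Au|²`, `tail_m ≤ ‖∇u‖²`, and Young's inequality; no Hölder in the measure):

* `rpow_le_of_interp` — the `ℝ≥0∞` algebra: `T ≤ Z < ∞`, `T·c ≤ L`, `0 < a ≤ r`, `4a + r ≤ 1` ⇒
  `T^r ≤ c^{-a} (L/(1+Z)⁴ + 1 + Z)`;
* `sublinearResolution_bound` — for `0 < a ≤ r`, `4a + r ≤ 1`: ONE `D = C(f,ν) + 1 + ‖f‖₂R/ν < ∞` with
  `∫ tail_m(u)^r dμ ≤ (4π²(m²+1))^{-a} · D` for every admissible law at `(f, ν, R)`, every level `N`, every cutoff `m`;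
* `exists_schedule_sublinear` / `sublinearResolution_schedule` (registered helper, verbatim header) — for every `0 < r < 1`: ONE schedule `κ_r` with `∫ tail_{κ_r n}(u)^r dμ ≤ 1/(n+1)`
  for every admissible law and every level (the crux's conclusion with the tail raised to the power `r`).

So the whole open content of the crux is the endpoint `r = 1` (equivalently uniform integrability of `‖∇u‖²`,
`…Reduction` + `…Converse`): every sub-critical moment of the enstrophy tail is `N`-uniformly resolved at the
energy-class budget, and nothing more is (NegativeNotesIdeator3G2 S1, here made a theorem with the tree's FGT
exponent `4`, whence the rate `m^{-(1-r)/2}` at `a = (1-r)/4`).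
-/

noncomputable section

-- `Summit.<Summit>.<Problem>`: single-conjunct summit, the duplicate namespace segment is mandated.
set_option linter.dupNamespace false

namespace Summit.AnomalousDissipation.AnomalousDissipation.Theorems.MomentParityResolvedDissipation

open MeasureTheory Filter Topology
open scoped ENNReal InnerProductSpace RealInnerProductSpace
open Literature.Analysis.FunctionSpaces Literature.Analysis.FluidPDE
open Summit.AnomalousDissipation.AnomalousDissipation.Theses.MomentParity
open Summit.AnomalousDissipation.AnomalousDissipation.Theorems.CubicParityLoud.Negative (T3 R3 H3 L2T3)
open Summit.AnomalousDissipation.AnomalousDissipation.Theorems.QuarticGate.Negative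
  (IsLevel IsBandTest polyGrad IsPolyStationary)
open Summit.AnomalousDissipation.AnomalousDissipation.Theorems.UniformResolution.Negative
  (eLapNormSq WeightedH2Bound tailGradNormSq_mul_le_eLapNormSq measurable_eLapNormSq_coe
    eGradNormSq_coe_eq_ofReal_gradSq)

/-! ## The pointwise interpolation -/

/-- **Pointwise sub-critical interpolation (pure `ℝ≥0∞` algebra).** If `T ≤ Z < ∞`, `T · c ≤ L` with
`0 < c < ∞`, and the exponents satisfy `0 < a ≤ r`, `4a + r ≤ 1`, then
`T ^ r ≤ (c⁻¹) ^ a · (L / (1+Z)⁴ + (1 + Z))`. Proof: with `B = 1 + Z` and `w = L/B⁴` (so `L = w B⁴`),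
`T^r = T^a T^{r-a} ≤ (c⁻¹ w B⁴)^a B^{r-a} = c^{-a} w^a B^{3a+r} ≤ c^{-a} w^a B^{1-a}` (`B ≥ 1`, `3a + r ≤ 1 − a`) and
Young `w^a B^{1-a} ≤ a w + (1−a) B ≤ w + B`. [folklore] -/
theorem rpow_le_of_interp {T Z L c : ℝ≥0∞} {r a : ℝ} (hTZ : T ≤ Z) (hZ : Z ≠ ⊤) (hcT : T * c ≤ L)
    (hc : c ≠ 0) (hc' : c ≠ ⊤) (ha : 0 < a) (har : a ≤ r) (h4 : 4 * a + r ≤ 1) :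
    T ^ r ≤ c⁻¹ ^ a * (L / (1 + Z) ^ 4 + (1 + Z)) := by
  set B : ℝ≥0∞ := 1 + Z with hB
  set w : ℝ≥0∞ := L / B ^ 4 with hw
  have hB1 : 1 ≤ B := le_self_add
  have hB0 : B ≠ 0 := (zero_lt_one.trans_le hB1).ne'
  have hBtop : B ≠ ⊤ := ENNReal.add_ne_top.2 ⟨ENNReal.one_ne_top, hZ⟩
  have hB4_0 : B ^ 4 ≠ 0 := pow_ne_zero _ hB0
  have hB4_top : B ^ 4 ≠ ⊤ := ENNReal.pow_ne_top hBtop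
  have hL : L = w * B ^ 4 := (ENNReal.div_mul_cancel hB4_0 hB4_top).symm
  have ha1 : a < 1 := by linarith
  have hra : 0 ≤ r - a := sub_nonneg.2 har
  -- `T ≤ c⁻¹ w B⁴` and `T ≤ B`
  have hT1 : T ≤ c⁻¹ * (w * B ^ 4) := by
    rw [← hL, mul_comm, ← div_eq_mul_inv]
    exact (ENNReal.le_div_iff_mul_le (Or.inl hc) (Or.inl hc')).2 hcT
  have hT2 : T ≤ B := hTZ.trans le_add_self
  -- the exponent bookkeeping on `B`
  have hB4 : (B ^ 4) ^ a * B ^ (r - a) ≤ B ^ (1 - a) := by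
    rw [show (B ^ 4 : ℝ≥0∞) = B ^ ((4 : ℕ) : ℝ) from (ENNReal.rpow_natCast B 4).symm, ← ENNReal.rpow_mul,
      ← ENNReal.rpow_add_of_nonneg _ _ (by positivity) hra]
    exact ENNReal.rpow_le_rpow_of_exponent_le hB1 (by push_cast; linarith)
  -- Young
  have hY : w ^ a * B ^ (1 - a) ≤ w + B := by
    have hpq : a⁻¹.HolderConjugate (1 - a)⁻¹ := Real.HolderConjugate.inv_one_sub_inv ha ha1
    have h := ENNReal.young_inequality (w ^ a) (B ^ (1 - a)) hpq
    rw [← ENNReal.rpow_mul, ← ENNReal.rpow_mul, mul_inv_cancel₀ ha.ne', mul_inv_cancel₀ (by linarith),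
      ENNReal.rpow_one, ENNReal.rpow_one] at h
    refine h.trans (add_le_add ?_ ?_)
    · refine ENNReal.div_le_of_le_mul (le_mul_of_one_le_right bot_le ?_)
      rw [← ENNReal.ofReal_one]
      exact ENNReal.ofReal_le_ofReal (by rw [← one_div]; exact one_le_one_div ha ha1.le)
    · refine ENNReal.div_le_of_le_mul (le_mul_of_one_le_right bot_le ?_)
      rw [← ENNReal.ofReal_one]
      exact ENNReal.ofReal_le_ofReal (by rw [← one_div]; exact one_le_one_div (by linarith) (by linarith))
  -- assemble
  calc T ^ r = T ^ (a + (r - a)) := by rw [add_sub_cancel]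
    _ = T ^ a * T ^ (r - a) := ENNReal.rpow_add_of_nonneg _ _ ha.le hra
    _ ≤ (c⁻¹ * (w * B ^ 4)) ^ a * B ^ (r - a) := by gcongr
    _ = c⁻¹ ^ a * (w ^ a * ((B ^ 4) ^ a * B ^ (r - a))) := by
        rw [ENNReal.mul_rpow_of_nonneg _ _ ha.le, ENNReal.mul_rpow_of_nonneg _ _ ha.le]; ring
    _ ≤ c⁻¹ ^ a * (w ^ a * B ^ (1 - a)) := by gcongr
    _ ≤ c⁻¹ ^ a * (w + B) := by gcongr

/-! ## The `N`-uniform bound on sub-critical tail moments -/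

/-- **SUBLINEAR RESOLUTION, quantitative form.** Let `f` be smooth, `ν > 0`, `R` real, and let the exponents satisfy
`0 < a ≤ r`, `4a + r ≤ 1` (e.g. `a = (1 − r)/4` for `1/5 ≤ r < 1`). There is ONE `D < ∞` (namely
`C_FGT(f, ν) + 1 + ‖f‖₂R/ν`) such that EVERY probability law on `H` carried by level-`N` fields, supported in
`‖u‖ ≤ R` and stationary for Galerkin NS at `(ν, f)` at every polynomial order satisfies, for every cutoff `m` and
every level `N`, `∫ tail_m(u)^r dμ ≤ (4π²(m²+1))^{-a} · D`. Inputs: the energy-row budget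
(`ensembleEnstrophy_le_budget`), the FGT weighted `H²` bound (`weightedH2Bound_admissible`), spectral Chebyshev
(`tailGradNormSq_mul_le_eLapNormSq`) and the pointwise interpolation `rpow_le_of_interp`. [folklore] -/
theorem sublinearResolution_bound {ν : ℝ} (hν : 0 < ν) {f : T3 → R3} (hf : Torus.IsSmooth f) (R : ℝ)
    {r a : ℝ} (ha : 0 < a) (har : a ≤ r) (h4 : 4 * a + r ≤ 1) :
    ∃ D : ℝ≥0∞, D ≠ ⊤ ∧ ∀ (N : ℕ) (μ : Measure H3), IsProbabilityMeasure μ →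
      (∀ᵐ u ∂μ, IsLevel N u) → (∀ᵐ u ∂μ, ‖u‖ ≤ R) → (∀ d : ℕ, IsPolyStationary ν f N d μ) →
      ∀ m : ℕ, ∫⁻ u, Torus.tailGradNormSq m (u.1 : T3 → R3) ^ r ∂μ ≤
        (ENNReal.ofReal (4 * Real.pi ^ 2 * ((m : ℝ) ^ 2 + 1)))⁻¹ ^ a * D := by
  obtain ⟨C, hC, hW⟩ := weightedH2Bound_admissible hν hf R
  set G : ℝ≥0∞ := ENNReal.ofReal (Real.sqrt (∫ x, ‖f x‖ ^ 2) * R / ν) with hG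
  refine ⟨C + 1 + G, ENNReal.add_ne_top.2 ⟨ENNReal.add_ne_top.2 ⟨hC, ENNReal.one_ne_top⟩, ENNReal.ofReal_ne_top⟩,
    fun N μ hp hl hb hs m => ?_⟩
  set c : ℝ≥0∞ := ENNReal.ofReal (4 * Real.pi ^ 2 * ((m : ℝ) ^ 2 + 1)) with hc
  have hc0 : c ≠ 0 := (ENNReal.ofReal_pos.2 (by positivity)).ne'
  have hctop : c ≠ ⊤ := ENNReal.ofReal_ne_top
  -- abbreviations for the three spectral functionals of the state
  set Z : H3 → ℝ≥0∞ := fun u => Torus.eGradNormSq ((u.1 : L2T3) : T3 → R3) with hZ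
  set L : H3 → ℝ≥0∞ := fun u => eLapNormSq ((u.1 : L2T3) : T3 → R3) with hL
  set T : H3 → ℝ≥0∞ := fun u => Torus.tailGradNormSq m ((u.1 : L2T3) : T3 → R3) with hT
  -- the a.e. pointwise bound (level-`N` states have finite enstrophy)
  have hae : ∀ᵐ u ∂μ, T u ^ r ≤ c⁻¹ ^ a * (L u / (1 + Z u) ^ 4 + (1 + Z u)) := by
    filter_upwards [hl] with u hu
    refine rpow_le_of_interp (Torus.tailGradNormSq_le m _) ?_ (tailGradNormSq_mul_le_eLapNormSq m _)
      hc0 hctop ha har h4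
    simp only [hZ]
    rw [eGradNormSq_coe_eq_ofReal_gradSq hu]
    exact ENNReal.ofReal_ne_top
  -- integrate
  have hmZ : Measurable Z := Torus.measurable_eGradNormSq_coe
  have hmW : Measurable fun u : H3 => L u / (1 + Z u) ^ 4 :=
    measurable_eLapNormSq_coe.div ((hmZ.const_add 1).pow_const 4)
  have hmB : Measurable fun u : H3 => 1 + Z u := hmZ.const_add 1
  calc ∫⁻ u, T u ^ r ∂μ ≤ ∫⁻ u, c⁻¹ ^ a * (L u / (1 + Z u) ^ 4 + (1 + Z u)) ∂μ := lintegral_mono_ae hae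
    _ = c⁻¹ ^ a * ((∫⁻ u, L u / (1 + Z u) ^ 4 ∂μ) + (1 + ∫⁻ u, Z u ∂μ)) := by
        rw [lintegral_const_mul (c⁻¹ ^ a)
            (show Measurable (fun u : H3 => L u / (1 + Z u) ^ 4 + (1 + Z u)) from hmW.add hmB),
          lintegral_add_left hmW, lintegral_add_left (measurable_const (a := (1 : ℝ≥0∞))), lintegral_const,
          measure_univ, mul_one]
    _ ≤ c⁻¹ ^ a * (C + (1 + G)) := by
        gcongr
        · exact hW μ ⟨hp, N, hl, hb, hs⟩
        · exact ensembleEnstrophy_le_budget hν (hf.memLp 2) hp hl hb hs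
    _ = c⁻¹ ^ a * (C + 1 + G) := by rw [add_assoc]

/-! ## One schedule resolves every sub-critical tail moment, uniformly in the level -/

/-- The spectral constant dominates the cutoff: `m ≤ 4π²(m²+1)` in `ℝ≥0∞`. [folklore] -/
theorem natCast_le_spectralConst (m : ℕ) :
    (m : ℝ≥0∞) ≤ ENNReal.ofReal (4 * Real.pi ^ 2 * ((m : ℝ) ^ 2 + 1)) := by
  rw [← ENNReal.ofReal_natCast]
  refine ENNReal.ofReal_le_ofReal ?_
  have hπ : (1 : ℝ) ≤ 4 * Real.pi ^ 2 := by nlinarith [Real.pi_gt_three]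
  calc (m : ℝ) ≤ (m : ℝ) ^ 2 + 1 := by nlinarith [sq_nonneg ((m : ℝ) - 1)]
    _ ≤ 4 * Real.pi ^ 2 * ((m : ℝ) ^ 2 + 1) := le_mul_of_one_le_left (by positivity) hπ

/-- **SUBLINEAR RESOLUTION, schedule form** (the crux's conclusion with the tail raised to any power `r < 1`).
For every smooth `f`, `ν > 0`, `R` and every exponent `0 < r < 1` there is ONE schedule `κ : ℕ → ℕ` such that EVERY
probability law on `H` carried by level-`N` fields, supported in `‖u‖ ≤ R` and stationary for Galerkin NS at `(ν, f)`
at every polynomial order satisfies, for all `n` and all levels `N`,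
`∫ (‖∇u‖² − ‖∇P_{κ n} u‖²)^r dμ ≤ 1/(n+1)`. The crux `ResolvedDissipation` is the endpoint `r = 1`
(there `∫ tail_{κ n} dμ ≤ 1/(n+1)` ⟺ `∫‖∇u‖² dμ ≤ ∫‖∇P_{κ n}u‖² dμ + 1/(n+1)`), which is equivalent to uniform
integrability of the enstrophy over the admissible family (`…Reduction`, `…Converse`) and open. [folklore] -/
theorem exists_schedule_sublinear {ν : ℝ} (hν : 0 < ν) {f : T3 → R3} (hf : Torus.IsSmooth f) (R : ℝ)
    {r : ℝ} (hr0 : 0 < r) (hr1 : r < 1) :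
    ∃ κ : ℕ → ℕ, ∀ (N : ℕ) (μ : Measure H3), IsProbabilityMeasure μ →
      (∀ᵐ u ∂μ, IsLevel N u) → (∀ᵐ u ∂μ, ‖u‖ ≤ R) → (∀ d : ℕ, IsPolyStationary ν f N d μ) →
      ∀ n : ℕ, ∫⁻ u, Torus.tailGradNormSq (κ n) (u.1 : T3 → R3) ^ r ∂μ ≤ ((n : ℝ≥0∞) + 1)⁻¹ := by
  set a : ℝ := min r ((1 - r) / 4) with ha_def
  have ha : 0 < a := lt_min hr0 (by linarith)
  have har : a ≤ r := min_le_left _ _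
  have h4 : 4 * a + r ≤ 1 := by
    have := min_le_right r ((1 - r) / 4)
    linarith
  obtain ⟨D, hD, hbound⟩ := sublinearResolution_bound hν hf R ha har h4
  -- the comparison rate `(m⁻¹)^a · D` tends to zero
  have t1 : Tendsto (fun m : ℕ => (m : ℝ≥0∞)⁻¹) atTop (𝓝 0) := ENNReal.tendsto_inv_nat_nhds_zero
  have t2 : Tendsto (fun m : ℕ => ((m : ℝ≥0∞)⁻¹) ^ a) atTop (𝓝 0) := by
    have h := ((ENNReal.continuous_rpow_const (y := a)).tendsto 0).comp t1
    simpa only [Function.comp_def, ENNReal.zero_rpow_of_pos ha] using h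
  have t3 : Tendsto (fun m : ℕ => ((m : ℝ≥0∞)⁻¹) ^ a * D) atTop (𝓝 0) := by
    simpa only [zero_mul] using ENNReal.Tendsto.mul_const t2 (Or.inr hD)
  -- choose the cutoff level by level of tolerance
  have hκ : ∀ n : ℕ, ∃ m : ℕ,
      (ENNReal.ofReal (4 * Real.pi ^ 2 * ((m : ℝ) ^ 2 + 1)))⁻¹ ^ a * D ≤ ((n : ℝ≥0∞) + 1)⁻¹ := by
    intro n
    have hpos : (0 : ℝ≥0∞) < ((n : ℝ≥0∞) + 1)⁻¹ :=
      ENNReal.inv_pos.2 (ENNReal.add_ne_top.2 ⟨ENNReal.natCast_ne_top n, ENNReal.one_ne_top⟩)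
    obtain ⟨m, hm⟩ := ((tendsto_order.1 t3).2 _ hpos).exists
    refine ⟨m, le_trans ?_ hm.le⟩
    gcongr
    exact natCast_le_spectralConst m
  choose κ hκ using hκ
  exact ⟨κ, fun N μ hp hl hb hs n => (hbound N μ hp hl hb hs (κ n)).trans (hκ n)⟩

/-- **Registered helper `sublinearResolution_schedule`** (`ledger workitem stub-add stmt-AnomalousDissipation-14284 --name
sublinearResolution_schedule`, lead c2): the schedule form `exists_schedule_sublinear` with the registered header verbatim —
for every `0 < r < 1` ONE schedule resolves the `r`-th moment of the enstrophy tail of every admissible law at `(f, ν, R)`,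
uniformly in the level; the crux `ResolvedDissipation` is the endpoint `r = 1`. [folklore] -/
theorem sublinearResolution_schedule : ∀ {ν : ℝ}, 0 < ν → ∀ {f : T3 → R3}, Torus.IsSmooth f → ∀ (R : ℝ) {r : ℝ}, 0 < r → r < 1 → ∃ κ : ℕ → ℕ, ∀ (N : ℕ) (μ : Measure H3), IsProbabilityMeasure μ → (∀ᵐ u ∂μ, IsLevel N u) → (∀ᵐ u ∂μ, ‖u‖ ≤ R) → (∀ d : ℕ, IsPolyStationary ν f N d μ) → ∀ n : ℕ, ∫⁻ u, Torus.tailGradNormSq (κ n) (u.1 : T3 → R3) ^ r ∂μ ≤ ((n : ℝ≥0∞) + 1)⁻¹ :=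
  fun hν _ hf R _ hr0 hr1 => exists_schedule_sublinear hν hf R hr0 hr1

end Summit.AnomalousDissipation.AnomalousDissipation.Theorems.MomentParityResolvedDissipation

end
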